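import Mathlib
import Literature.Probability.Process.PointStationaryLaw
import Literature.MathematicalPhysics.StatisticalMechanics.BarlowStacking
import Literature.MathematicalPhysics.StatisticalMechanics.Crystallization
import Literature.Geometry.DiscreteGeometry.TwoShellPatterns
import Summits.AtomisticToContinuum.Crystallization.Theorems.FrustratedLawDichotomyTransportPrice

/-!
# ChartedPlanarOrder — the LAW STEP of the perturbative energy line: KPERT(ν) ⟹ QMC(ν)  (DEF-FREE helper; lens-3 g19)

`QMC(ν)` (quadratic mean coercivity; lens-3 g18 `AmplitudeCut.QuadMeanCoercivity`, the text of the preview stub `stub_quadMeanCoercivity`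
of `bc/AmplitudeCut_birth.lean` c966ab35 at `ν = 1/50`) says: under N's energy/structure hypotheses plus «`ν`-matched about every atom a.s.»,
`e⋆ + c·E_P[m²] ≤ E_P[rootEnergy]` for a measurable majorant `m` of the root misfit.  `KPERT(ν)` (lens-3 g19 `AmplitudeCut.PertSiteCalibration`)
is its DETERMINISTIC SITEWISE form: one jointly measurable covariant transport `F` with bounded out-flow such that every rooted configuration of
the perturbative class has redistributed root energy `≥ e⋆`, and `≥ e⋆ + c·η²` when the root window is not `η`-matched.  This file proves
KPERT(ν) ⟹ QMC(ν) for every `ν` by the mass-transport principle (`FrustratedLawDichotomyTransportPrice.integral_redistributed_eq`, hands g3):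
the transport terms cancel in the `P`-mean, and `m = √((redistributed − e⋆)/c)` (measurable modification) is the majorant.
No `def`; both statements expanded verbatim (source of the texts: run/shared/lean/pub/decomp-a2c/decomp-a2c-lens-3/g19/sigs19.json).
-/

namespace Summit.AtomisticToContinuum.Crystallization.Theorems.ChartedPlanarOrderPertCalibration

open MeasureTheory
open scoped ENNReal
open Summit.AtomisticToContinuum.Crystallization.Theorems.FrustratedLawDichotomyTransportPrice
  (integral_redistributed_eq lintegral_outflow_ne_top_of_bound)

/-- **KPERT(ν) ⟹ QMC(ν)** (sitewise calibrated quadratic coercivity in the perturbative regime ⟹ quadratic MEAN coercivity under every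
point-stationary hard-core law of that regime), by the mass-transport principle. -/
theorem quadMeanCoercivity_of_pertSiteCalibration (ν : ℝ)
    (hK : ∃ c : ℝ, 0 < c ∧ ∃ η₀ : ℝ, 0 < η₀ ∧ ∀ δ : ℝ, 0 < δ → ∃ C : NNReal, ∃ F : MeasureTheory.Measure (EuclideanSpace ℝ (Fin 3)) → EuclideanSpace ℝ (Fin 3) → ENNReal, Measurable (Function.uncurry F) ∧ ∀ μ : MeasureTheory.Measure (EuclideanSpace ℝ (Fin 3)), (∃ S : Set (EuclideanSpace ℝ (Fin 3)), (0 : EuclideanSpace ℝ (Fin 3)) ∈ S ∧ (∀ x ∈ S, ∀ y ∈ S, x ≠ y → δ ≤ dist x y) ∧ μ = (MeasureTheory.Measure.count : MeasureTheory.Measure (EuclideanSpace ℝ (Fin 3))).restrict S) → (∀ q : EuclideanSpace ℝ (Fin 3), μ {q} ≠ 0 → Literature.Geometry.DiscreteGeometry.IsTwoShellGoodSet (1 / 16) (9 / 10) 1 {p : EuclideanSpace ℝ (Fin 3) | μ {p} ≠ 0} q) → (∀ p : EuclideanSpace ℝ (Fin 3), μ {p} ≠ 0 → ∀ y : EuclideanSpace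 ℝ (Fin 3), (∀ q : EuclideanSpace ℝ (Fin 3), μ {q} ≠ 0 → q ≠ p → y ≠ q) → ∑' q : {q : EuclideanSpace ℝ (Fin 3) // μ {q} ≠ 0 ∧ q ≠ p}, Literature.MathematicalPhysics.StatisticalMechanics.lennardJones (dist p (q : EuclideanSpace ℝ (Fin 3))) ≤ ∑' q : {q : EuclideanSpace ℝ (Fin 3) // μ {q} ≠ 0 ∧ q ≠ p}, Literature.MathematicalPhysics.StatisticalMechanics.lennardJones (dist y (q : EuclideanSpace ℝ (Fin 3)))) → (∃ s : ℤ → ℤ, Literature.MathematicalPhysics.StatisticalMechanics.IsHaggSeq s ∧ ∃ Φ : EuclideanSpace ℝ (Fin 3) → EuclideanSpace ℝ (Fin 3), Set.BijOn Φ (Literature.MathematicalPhysics.StatisticalMechanics.barlowStacking 1 (Real.sqrt (2 / 3)) s) {p : EuclideanSpace ℝ (Fin 3) | μ {p} ≠ 0} ∧ ∀ p ∈ Literature.MathematicalPhysics.StatisticalMechanics.barlowStacking 1 (Real.sqrt (2 / 3)) s, ∀ q ∈ Literature.MathematicalPhysics.StatisticalMechanics.barlowStacking 1 (Real.sqrt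 (2 / 3)) s, (dist p q = 1 ↔ (0 < dist (Φ p) (Φ q) ∧ dist (Φ p) (Φ q) ≤ 28 / 25))) → (∀ q : EuclideanSpace ℝ (Fin 3), μ {q} ≠ 0 → ∃ b : ℝ, 9 / 10 ≤ b ∧ b ≤ 1 ∧ ∃ (A : EuclideanSpace ℝ (Fin 3) →ₗᵢ[ℝ] EuclideanSpace ℝ (Fin 3)) (s : ℤ → ℤ) (z : ℤ → ℝ), Literature.MathematicalPhysics.StatisticalMechanics.IsHaggSeq s ∧ (∀ m : ℤ, 39 / 50 * b ≤ z (m + 1) - z m ∧ z (m + 1) - z m ≤ 17 / 20 * b) ∧ z 0 = 0 ∧ (∀ y : EuclideanSpace ℝ (Fin 3), dist y q ≤ 4 * b → μ {y} ≠ 0 → ∃ y' : EuclideanSpace ℝ (Fin 3), y' - q ∈ {p | ∃ m i j : ℤ, p = A (((i : ℝ) • Literature.MathematicalPhysics.StatisticalMechanics.triangularVec₁ b) + ((j : ℝ) • Literature.MathematicalPhysics.StatisticalMechanics.triangularVec₂ b) + ((Literature.MathematicalPhysics.StatisticalMechanics.haggLabel s m : ℝ) • Literature.MathematicalPhysics.StatisticalMechanics.barlowOffset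 b) + (z m • Literature.MathematicalPhysics.StatisticalMechanics.layerNormal 1))} ∧ dist y y' ≤ ν) ∧ (∀ y' : EuclideanSpace ℝ (Fin 3), y' - q ∈ {p | ∃ m i j : ℤ, p = A (((i : ℝ) • Literature.MathematicalPhysics.StatisticalMechanics.triangularVec₁ b) + ((j : ℝ) • Literature.MathematicalPhysics.StatisticalMechanics.triangularVec₂ b) + ((Literature.MathematicalPhysics.StatisticalMechanics.haggLabel s m : ℝ) • Literature.MathematicalPhysics.StatisticalMechanics.barlowOffset b) + (z m • Literature.MathematicalPhysics.StatisticalMechanics.layerNormal 1))} → dist y' q ≤ 5 * b → ∃ y : EuclideanSpace ℝ (Fin 3), μ {y} ≠ 0 ∧ dist y y' ≤ ν)) → (∫⁻ y, F μ y ∂μ) ≤ (C : ENNReal) ∧ (⨅ Q : Literature.MathematicalPhysics.StatisticalMechanics.PeriodicConfiguration 3, Q.energyPerParticle Literature.MathematicalPhysics.StatisticalMechanics.lennardJones) ≤ (∫ y, Literature.MathematicalPhysics.StatisticalMechanics.lennardJones ‖y‖ ∂μ) / 2 + (∫⁻ y, F (MeasureTheory.Measure.map (fun z => z - y) μ) (-y)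 ∂μ).toReal - (∫⁻ y, F μ y ∂μ).toReal ∧ ∀ η : ℝ, 0 < η → η ≤ η₀ → ¬ (∃ b : ℝ, 9 / 10 ≤ b ∧ b ≤ 1 ∧ ∃ (A : EuclideanSpace ℝ (Fin 3) →ₗᵢ[ℝ] EuclideanSpace ℝ (Fin 3)) (s : ℤ → ℤ) (z : ℤ → ℝ), Literature.MathematicalPhysics.StatisticalMechanics.IsHaggSeq s ∧ (∀ m : ℤ, 39 / 50 * b ≤ z (m + 1) - z m ∧ z (m + 1) - z m ≤ 17 / 20 * b) ∧ z 0 = 0 ∧ (∀ y : EuclideanSpace ℝ (Fin 3), dist y (0 : EuclideanSpace ℝ (Fin 3)) ≤ 4 * b → y ∈ {p : EuclideanSpace ℝ (Fin 3) | μ {p} ≠ 0} → ∃ y' : EuclideanSpace ℝ (Fin 3), y' - (0 : EuclideanSpace ℝ (Fin 3)) ∈ {p | ∃ m i j : ℤ, p = A (((i : ℝ) • Literature.MathematicalPhysics.StatisticalMechanics.triangularVec₁ b) + ((j : ℝ) • Literature.MathematicalPhysics.StatisticalMechanics.triangularVec₂ b) + ((Literature.MathematicalPhysics.StatisticalMechanics.haggLabel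 s m : ℝ) • Literature.MathematicalPhysics.StatisticalMechanics.barlowOffset b) + (z m • Literature.MathematicalPhysics.StatisticalMechanics.layerNormal 1))} ∧ dist y y' ≤ η) ∧ (∀ y' : EuclideanSpace ℝ (Fin 3), y' - (0 : EuclideanSpace ℝ (Fin 3)) ∈ {p | ∃ m i j : ℤ, p = A (((i : ℝ) • Literature.MathematicalPhysics.StatisticalMechanics.triangularVec₁ b) + ((j : ℝ) • Literature.MathematicalPhysics.StatisticalMechanics.triangularVec₂ b) + ((Literature.MathematicalPhysics.StatisticalMechanics.haggLabel s m : ℝ) • Literature.MathematicalPhysics.StatisticalMechanics.barlowOffset b) + (z m • Literature.MathematicalPhysics.StatisticalMechanics.layerNormal 1))} → dist y' (0 : EuclideanSpace ℝ (Fin 3)) ≤ 5 * b → ∃ y : EuclideanSpace ℝ (Fin 3), y ∈ {p : EuclideanSpace ℝ (Fin 3) | μ {p} ≠ 0} ∧ dist y y' ≤ η)) → (⨅ Q : Literature.MathematicalPhysics.StatisticalMechanics.PeriodicConfiguration 3, Q.energyPerParticle Literature.MathematicalPhysics.StatisticalMechanics.lennardJones) + c * η ^ 2 ≤ (∫ y,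 Literature.MathematicalPhysics.StatisticalMechanics.lennardJones ‖y‖ ∂μ) / 2 + (∫⁻ y, F (MeasureTheory.Measure.map (fun z => z - y) μ) (-y) ∂μ).toReal - (∫⁻ y, F μ y ∂μ).toReal) :
    ∃ c : ℝ, 0 < c ∧ ∃ η₀ : ℝ, 0 < η₀ ∧ ∀ δ : ℝ, 0 < δ → ∀ P : MeasureTheory.Measure (MeasureTheory.Measure (EuclideanSpace ℝ (Fin 3))), MeasureTheory.IsProbabilityMeasure P → (∀ᵐ μ ∂P, (∃ S : Set (EuclideanSpace ℝ (Fin 3)), (0 : EuclideanSpace ℝ (Fin 3)) ∈ S ∧ (∀ x ∈ S, ∀ y ∈ S, x ≠ y → δ ≤ dist x y) ∧ μ = (MeasureTheory.Measure.count : MeasureTheory.Measure (EuclideanSpace ℝ (Fin 3))).restrict S)) → (∀ g : MeasureTheory.Measure (EuclideanSpace ℝ (Fin 3)) → EuclideanSpace ℝ (Fin 3) → ENNReal, Measurable (Function.uncurry g) → ∫⁻ μ, ∫⁻ y, g μ y ∂μ ∂P = ∫⁻ μ, ∫⁻ y, g (MeasureTheory.Measure.map (fun z => z - y) μ) (-y)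 ∂μ ∂P) → (∀ᵐ μ ∂P, ∀ q : EuclideanSpace ℝ (Fin 3), μ {q} ≠ 0 → Literature.Geometry.DiscreteGeometry.IsTwoShellGoodSet (1 / 16) (9 / 10) 1 {p : EuclideanSpace ℝ (Fin 3) | μ {p} ≠ 0} q) → (∀ᵐ μ ∂P, ∀ p : EuclideanSpace ℝ (Fin 3), μ {p} ≠ 0 → ∀ y : EuclideanSpace ℝ (Fin 3), (∀ q : EuclideanSpace ℝ (Fin 3), μ {q} ≠ 0 → q ≠ p → y ≠ q) → ∑' q : {q : EuclideanSpace ℝ (Fin 3) // μ {q} ≠ 0 ∧ q ≠ p}, Literature.MathematicalPhysics.StatisticalMechanics.lennardJones (dist p (q : EuclideanSpace ℝ (Fin 3))) ≤ ∑' q : {q : EuclideanSpace ℝ (Fin 3) // μ {q} ≠ 0 ∧ q ≠ p}, Literature.MathematicalPhysics.StatisticalMechanics.lennardJones (dist y (q : EuclideanSpace ℝ (Fin 3)))) → (∀ᵐ μ ∂P, ∃ s : ℤ → ℤ, Literature.MathematicalPhysics.StatisticalMechanics.IsHaggSeq s ∧ ∃ Φ : EuclideanSpace ℝ (Fin 3)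 → EuclideanSpace ℝ (Fin 3), Set.BijOn Φ (Literature.MathematicalPhysics.StatisticalMechanics.barlowStacking 1 (Real.sqrt (2 / 3)) s) {p : EuclideanSpace ℝ (Fin 3) | μ {p} ≠ 0} ∧ ∀ p ∈ Literature.MathematicalPhysics.StatisticalMechanics.barlowStacking 1 (Real.sqrt (2 / 3)) s, ∀ q ∈ Literature.MathematicalPhysics.StatisticalMechanics.barlowStacking 1 (Real.sqrt (2 / 3)) s, (dist p q = 1 ↔ (0 < dist (Φ p) (Φ q) ∧ dist (Φ p) (Φ q) ≤ 28 / 25))) → (∀ᵐ μ ∂P, ∀ q : EuclideanSpace ℝ (Fin 3), μ {q} ≠ 0 → ∃ b : ℝ, 9 / 10 ≤ b ∧ b ≤ 1 ∧ ∃ (A : EuclideanSpace ℝ (Fin 3) →ₗᵢ[ℝ] EuclideanSpace ℝ (Fin 3)) (s : ℤ → ℤ) (z : ℤ → ℝ), Literature.MathematicalPhysics.StatisticalMechanics.IsHaggSeq s ∧ (∀ m : ℤ, 39 / 50 * b ≤ z (m + 1) - z m ∧ z (m + 1) - z m ≤ 17 / 20 * b) ∧ z 0 = 0 ∧ (∀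 y : EuclideanSpace ℝ (Fin 3), dist y q ≤ 4 * b → μ {y} ≠ 0 → ∃ y' : EuclideanSpace ℝ (Fin 3), y' - q ∈ {p | ∃ m i j : ℤ, p = A (((i : ℝ) • Literature.MathematicalPhysics.StatisticalMechanics.triangularVec₁ b) + ((j : ℝ) • Literature.MathematicalPhysics.StatisticalMechanics.triangularVec₂ b) + ((Literature.MathematicalPhysics.StatisticalMechanics.haggLabel s m : ℝ) • Literature.MathematicalPhysics.StatisticalMechanics.barlowOffset b) + (z m • Literature.MathematicalPhysics.StatisticalMechanics.layerNormal 1))} ∧ dist y y' ≤ ν) ∧ (∀ y' : EuclideanSpace ℝ (Fin 3), y' - q ∈ {p | ∃ m i j : ℤ, p = A (((i : ℝ) • Literature.MathematicalPhysics.StatisticalMechanics.triangularVec₁ b) + ((j : ℝ) • Literature.MathematicalPhysics.StatisticalMechanics.triangularVec₂ b) + ((Literature.MathematicalPhysics.StatisticalMechanics.haggLabel s m : ℝ) • Literature.MathematicalPhysics.StatisticalMechanics.barlowOffset b) + (z m • Literature.MathematicalPhysics.StatisticalMechanics.layerNormal 1))} → dist y' q ≤ 5 * b → ∃ y : EuclideanSpace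 ℝ (Fin 3), μ {y} ≠ 0 ∧ dist y y' ≤ ν)) → ∃ m : (MeasureTheory.Measure (EuclideanSpace ℝ (Fin 3))) → ENNReal, Measurable m ∧ (∀ᵐ μ ∂P, ∀ η : ℝ, 0 < η → η ≤ η₀ → ¬ (∃ b : ℝ, 9 / 10 ≤ b ∧ b ≤ 1 ∧ ∃ (A : EuclideanSpace ℝ (Fin 3) →ₗᵢ[ℝ] EuclideanSpace ℝ (Fin 3)) (s : ℤ → ℤ) (z : ℤ → ℝ), Literature.MathematicalPhysics.StatisticalMechanics.IsHaggSeq s ∧ (∀ m : ℤ, 39 / 50 * b ≤ z (m + 1) - z m ∧ z (m + 1) - z m ≤ 17 / 20 * b) ∧ z 0 = 0 ∧ (∀ y : EuclideanSpace ℝ (Fin 3), dist y (0 : EuclideanSpace ℝ (Fin 3)) ≤ 4 * b → y ∈ {p : EuclideanSpace ℝ (Fin 3) | μ {p} ≠ 0} → ∃ y' : EuclideanSpace ℝ (Fin 3), y' - (0 : EuclideanSpace ℝ (Fin 3)) ∈ {p | ∃ m i j : ℤ, p = A (((i : ℝ) • Literature.MathematicalPhysics.StatisticalMechanics.triangularVec₁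 b) + ((j : ℝ) • Literature.MathematicalPhysics.StatisticalMechanics.triangularVec₂ b) + ((Literature.MathematicalPhysics.StatisticalMechanics.haggLabel s m : ℝ) • Literature.MathematicalPhysics.StatisticalMechanics.barlowOffset b) + (z m • Literature.MathematicalPhysics.StatisticalMechanics.layerNormal 1))} ∧ dist y y' ≤ η) ∧ (∀ y' : EuclideanSpace ℝ (Fin 3), y' - (0 : EuclideanSpace ℝ (Fin 3)) ∈ {p | ∃ m i j : ℤ, p = A (((i : ℝ) • Literature.MathematicalPhysics.StatisticalMechanics.triangularVec₁ b) + ((j : ℝ) • Literature.MathematicalPhysics.StatisticalMechanics.triangularVec₂ b) + ((Literature.MathematicalPhysics.StatisticalMechanics.haggLabel s m : ℝ) • Literature.MathematicalPhysics.StatisticalMechanics.barlowOffset b) + (z m • Literature.MathematicalPhysics.StatisticalMechanics.layerNormal 1))} → dist y' (0 : EuclideanSpace ℝ (Fin 3)) ≤ 5 * b → ∃ y : EuclideanSpace ℝ (Fin 3), y ∈ {p : EuclideanSpace ℝ (Fin 3) | μ {p} ≠ 0} ∧ dist y y' ≤ η)) → ENNReal.ofReal η ≤ m μ) ∧ (∫⁻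 μ, m μ ^ 2 ∂P) ≠ ⊤ ∧ (⨅ Q : Literature.MathematicalPhysics.StatisticalMechanics.PeriodicConfiguration 3, Q.energyPerParticle Literature.MathematicalPhysics.StatisticalMechanics.lennardJones) + c * (∫⁻ μ, m μ ^ 2 ∂P).toReal ≤ (∫ μ, (∫ y, Literature.MathematicalPhysics.StatisticalMechanics.lennardJones ‖y‖ ∂μ) / 2 ∂P) := by
  classical
  obtain ⟨c, hc, η₀, hη₀, h⟩ := hK
  refine ⟨c, hc, η₀, hη₀, ?_⟩
  intro δ hδ P hP hroot hmecke hclean hnash hchart hpert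
  obtain ⟨C, F, hF, hcal⟩ := h δ hδ
  haveI := hP
  have hcore : ∀ᵐ μ ∂P, Literature.Probability.Process.IsRootedHardCore δ μ := by
    filter_upwards [hroot] with μ hμ
    exact hμ
  have hstat : Literature.Probability.Process.IsPointStationaryLaw P := hmecke
  set eS : ℝ := (⨅ Q : Literature.MathematicalPhysics.StatisticalMechanics.PeriodicConfiguration 3, Q.energyPerParticle Literature.MathematicalPhysics.StatisticalMechanics.lennardJones) with he
  set g : Measure (EuclideanSpace ℝ (Fin 3)) → ℝ := fun μ => Literature.MathematicalPhysics.StatisticalMechanics.rootEnergy Literature.MathematicalPhysics.StatisticalMechanics.lennardJones μ + (∫⁻ y, F (MeasureTheory.Measure.map (fun z => z - y) μ) (-y) ∂μ).toReal - (∫⁻ y, F μ y ∂μ).toReal with hg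
  have hall : ∀ᵐ μ ∂P, (∫⁻ y, F μ y ∂μ) ≤ (C : ENNReal) ∧ eS ≤ g μ ∧
      ∀ η : ℝ, 0 < η → η ≤ η₀ → ¬ (∃ b : ℝ, 9 / 10 ≤ b ∧ b ≤ 1 ∧ ∃ (A : EuclideanSpace ℝ (Fin 3) →ₗᵢ[ℝ] EuclideanSpace ℝ (Fin 3)) (s : ℤ → ℤ) (z : ℤ → ℝ), Literature.MathematicalPhysics.StatisticalMechanics.IsHaggSeq s ∧ (∀ m : ℤ, 39 / 50 * b ≤ z (m + 1) - z m ∧ z (m + 1) - z m ≤ 17 / 20 * b) ∧ z 0 = 0 ∧ (∀ y : EuclideanSpace ℝ (Fin 3), dist y (0 : EuclideanSpace ℝ (Fin 3)) ≤ 4 * b → y ∈ {p : EuclideanSpace ℝ (Fin 3) | μ {p} ≠ 0} → ∃ y' : EuclideanSpace ℝ (Fin 3), y' - (0 : EuclideanSpace ℝ (Fin 3)) ∈ {p | ∃ m i j : ℤ, p = A (((i : ℝ) • Literature.MathematicalPhysics.StatisticalMechanics.triangularVec₁ b) + ((j : ℝ) • Literature.MathematicalPhysics.StatisticalMechanics.triangularVec₂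 b) + ((Literature.MathematicalPhysics.StatisticalMechanics.haggLabel s m : ℝ) • Literature.MathematicalPhysics.StatisticalMechanics.barlowOffset b) + (z m • Literature.MathematicalPhysics.StatisticalMechanics.layerNormal 1))} ∧ dist y y' ≤ η) ∧ (∀ y' : EuclideanSpace ℝ (Fin 3), y' - (0 : EuclideanSpace ℝ (Fin 3)) ∈ {p | ∃ m i j : ℤ, p = A (((i : ℝ) • Literature.MathematicalPhysics.StatisticalMechanics.triangularVec₁ b) + ((j : ℝ) • Literature.MathematicalPhysics.StatisticalMechanics.triangularVec₂ b) + ((Literature.MathematicalPhysics.StatisticalMechanics.haggLabel s m : ℝ) • Literature.MathematicalPhysics.StatisticalMechanics.barlowOffset b) + (z m • Literature.MathematicalPhysics.StatisticalMechanics.layerNormal 1))} → dist y' (0 : EuclideanSpace ℝ (Fin 3)) ≤ 5 * b → ∃ y : EuclideanSpace ℝ (Fin 3), y ∈ {p : EuclideanSpace ℝ (Fin 3) | μ {p} ≠ 0} ∧ dist y y' ≤ η)) → eS + c * η ^ 2 ≤ g μ := by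
    filter_upwards [hroot, hclean, hnash, hchart, hpert] with μ h1 h2 h3 h4 h5
    exact hcal μ h1 h2 h3 h4 h5
  have hout : ∫⁻ μ, ∫⁻ y, F μ y ∂μ ∂P ≠ ∞ :=
    lintegral_outflow_ne_top_of_bound (C := (C : ENNReal)) ENNReal.coe_ne_top (by
      filter_upwards [hall] with μ hμ
      exact hμ.1)
  obtain ⟨hI, heq⟩ := integral_redistributed_eq hδ hcore hstat hF hout
  set f : Measure (EuclideanSpace ℝ (Fin 3)) → ℝ := fun μ => (g μ - eS) / c with hf
  have hIf : Integrable f P := (hI.sub (integrable_const eS)).div_const c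
  have hf_nonneg : 0 ≤ᵐ[P] f := by
    filter_upwards [hall] with μ hμ
    have h2 : eS ≤ g μ := hμ.2.1
    show 0 ≤ (g μ - eS) / c
    exact div_nonneg (sub_nonneg.mpr h2) hc.le
  set m₀ : Measure (EuclideanSpace ℝ (Fin 3)) → ℝ≥0∞ := fun μ => ENNReal.ofReal (Real.sqrt (f μ)) with hm₀def
  have hm₀ : AEMeasurable m₀ P :=
    ENNReal.measurable_ofReal.comp_aemeasurable
      (Real.continuous_sqrt.measurable.comp_aemeasurable hIf.aestronglyMeasurable.aemeasurable)
  have hsq : ∀ μ, 0 ≤ f μ → m₀ μ ^ 2 = ENNReal.ofReal (f μ) := by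
    intro μ hμ
    show ENNReal.ofReal (Real.sqrt (f μ)) ^ 2 = ENNReal.ofReal (f μ)
    rw [← ENNReal.ofReal_pow (Real.sqrt_nonneg _), Real.sq_sqrt hμ]
  have hlin : ∫⁻ μ, (hm₀.mk m₀) μ ^ 2 ∂P = ENNReal.ofReal (∫ μ, f μ ∂P) := by
    have h1 : ∫⁻ μ, (hm₀.mk m₀) μ ^ 2 ∂P = ∫⁻ μ, ENNReal.ofReal (f μ) ∂P := by
      apply lintegral_congr_ae
      filter_upwards [hm₀.ae_eq_mk, hf_nonneg] with μ hmk hμ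
      rw [← hsq μ hμ, hmk]
    rw [h1, MeasureTheory.ofReal_integral_eq_lintegral_ofReal hIf hf_nonneg]
  refine ⟨hm₀.mk m₀, hm₀.measurable_mk, ?_, ?_, ?_⟩
  · filter_upwards [hall, hm₀.ae_eq_mk] with μ hμ hmk
    intro η hη hηle hnm
    have h2 : eS + c * η ^ 2 ≤ g μ := hμ.2.2 η hη hηle hnm
    have h3 : η ^ 2 ≤ f μ := by
      show η ^ 2 ≤ (g μ - eS) / c
      rw [le_div_iff₀ hc]
      linarith
    have h4 : η ≤ Real.sqrt (f μ) := by
      calc η = Real.sqrt (η ^ 2) := by rw [Real.sqrt_sq hη.le]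
        _ ≤ Real.sqrt (f μ) := Real.sqrt_le_sqrt h3
    have h5 : ENNReal.ofReal η ≤ m₀ μ := ENNReal.ofReal_le_ofReal h4
    rw [← hmk]
    exact h5
  · rw [hlin]
    exact ENNReal.ofReal_ne_top
  · rw [hlin, ENNReal.toReal_ofReal (integral_nonneg_of_ae hf_nonneg)]
    have hfint : ∫ μ, f μ ∂P = ((∫ μ, g μ ∂P) - eS) / c := by
      show ∫ μ, (g μ - eS) / c ∂P = _
      rw [integral_div, integral_sub hI (integrable_const eS), integral_const, smul_eq_mul, probReal_univ, one_mul]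
    rw [hfint, heq, mul_div_cancel₀ _ hc.ne']
    simp only [Literature.MathematicalPhysics.StatisticalMechanics.rootEnergy]
    linarith

/-- the same at the lineage's FIXED dial `ν₀ = 1/50` (conclusion = the text of the preview stub `stub_quadMeanCoercivity`, c966ab35). -/
theorem quadMeanCoercivity_of_pertSiteCalibration_1_50
    (hK : ∃ c : ℝ, 0 < c ∧ ∃ η₀ : ℝ, 0 < η₀ ∧ ∀ δ : ℝ, 0 < δ → ∃ C : NNReal, ∃ F : MeasureTheory.Measure (EuclideanSpace ℝ (Fin 3)) → EuclideanSpace ℝ (Fin 3) → ENNReal, Measurable (Function.uncurry F) ∧ ∀ μ : MeasureTheory.Measure (EuclideanSpace ℝ (Fin 3)), (∃ S : Set (EuclideanSpace ℝ (Fin 3)), (0 : EuclideanSpace ℝ (Fin 3)) ∈ S ∧ (∀ x ∈ S, ∀ y ∈ S, x ≠ y → δ ≤ dist x y) ∧ μ = (MeasureTheory.Measure.count : MeasureTheory.Measure (EuclideanSpace ℝ (Fin 3))).restrict S) → (∀ q : EuclideanSpace ℝ (Fin 3), μ {q} ≠ 0 → Literature.Geometry.DiscreteGeometry.IsTwoShellGoodSet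 (1 / 16) (9 / 10) 1 {p : EuclideanSpace ℝ (Fin 3) | μ {p} ≠ 0} q) → (∀ p : EuclideanSpace ℝ (Fin 3), μ {p} ≠ 0 → ∀ y : EuclideanSpace ℝ (Fin 3), (∀ q : EuclideanSpace ℝ (Fin 3), μ {q} ≠ 0 → q ≠ p → y ≠ q) → ∑' q : {q : EuclideanSpace ℝ (Fin 3) // μ {q} ≠ 0 ∧ q ≠ p}, Literature.MathematicalPhysics.StatisticalMechanics.lennardJones (dist p (q : EuclideanSpace ℝ (Fin 3))) ≤ ∑' q : {q : EuclideanSpace ℝ (Fin 3) // μ {q} ≠ 0 ∧ q ≠ p}, Literature.MathematicalPhysics.StatisticalMechanics.lennardJones (dist y (q : EuclideanSpace ℝ (Fin 3)))) → (∃ s : ℤ → ℤ, Literature.MathematicalPhysics.StatisticalMechanics.IsHaggSeq s ∧ ∃ Φ : EuclideanSpace ℝ (Fin 3) → EuclideanSpace ℝ (Fin 3), Set.BijOn Φ (Literature.MathematicalPhysics.StatisticalMechanics.barlowStacking 1 (Real.sqrt (2 / 3)) s) {p : EuclideanSpace ℝ (Fin 3) | μ {p} ≠ 0} ∧ ∀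 p ∈ Literature.MathematicalPhysics.StatisticalMechanics.barlowStacking 1 (Real.sqrt (2 / 3)) s, ∀ q ∈ Literature.MathematicalPhysics.StatisticalMechanics.barlowStacking 1 (Real.sqrt (2 / 3)) s, (dist p q = 1 ↔ (0 < dist (Φ p) (Φ q) ∧ dist (Φ p) (Φ q) ≤ 28 / 25))) → (∀ q : EuclideanSpace ℝ (Fin 3), μ {q} ≠ 0 → ∃ b : ℝ, 9 / 10 ≤ b ∧ b ≤ 1 ∧ ∃ (A : EuclideanSpace ℝ (Fin 3) →ₗᵢ[ℝ] EuclideanSpace ℝ (Fin 3)) (s : ℤ → ℤ) (z : ℤ → ℝ), Literature.MathematicalPhysics.StatisticalMechanics.IsHaggSeq s ∧ (∀ m : ℤ, 39 / 50 * b ≤ z (m + 1) - z m ∧ z (m + 1) - z m ≤ 17 / 20 * b) ∧ z 0 = 0 ∧ (∀ y : EuclideanSpace ℝ (Fin 3), dist y q ≤ 4 * b → μ {y} ≠ 0 → ∃ y' : EuclideanSpace ℝ (Fin 3), y' - q ∈ {p | ∃ m i j : ℤ, p = A (((i : ℝ) • Literature.MathematicalPhysics.StatisticalMechanics.triangularVec₁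 b) + ((j : ℝ) • Literature.MathematicalPhysics.StatisticalMechanics.triangularVec₂ b) + ((Literature.MathematicalPhysics.StatisticalMechanics.haggLabel s m : ℝ) • Literature.MathematicalPhysics.StatisticalMechanics.barlowOffset b) + (z m • Literature.MathematicalPhysics.StatisticalMechanics.layerNormal 1))} ∧ dist y y' ≤ 1 / 50) ∧ (∀ y' : EuclideanSpace ℝ (Fin 3), y' - q ∈ {p | ∃ m i j : ℤ, p = A (((i : ℝ) • Literature.MathematicalPhysics.StatisticalMechanics.triangularVec₁ b) + ((j : ℝ) • Literature.MathematicalPhysics.StatisticalMechanics.triangularVec₂ b) + ((Literature.MathematicalPhysics.StatisticalMechanics.haggLabel s m : ℝ) • Literature.MathematicalPhysics.StatisticalMechanics.barlowOffset b) + (z m • Literature.MathematicalPhysics.StatisticalMechanics.layerNormal 1))} → dist y' q ≤ 5 * b → ∃ y : EuclideanSpace ℝ (Fin 3), μ {y} ≠ 0 ∧ dist y y' ≤ 1 / 50)) → (∫⁻ y, F μ y ∂μ) ≤ (C : ENNReal) ∧ (⨅ Q : Literature.MathematicalPhysics.StatisticalMechanics.PeriodicConfiguration 3, Q.energyPerParticle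 Literature.MathematicalPhysics.StatisticalMechanics.lennardJones) ≤ (∫ y, Literature.MathematicalPhysics.StatisticalMechanics.lennardJones ‖y‖ ∂μ) / 2 + (∫⁻ y, F (MeasureTheory.Measure.map (fun z => z - y) μ) (-y) ∂μ).toReal - (∫⁻ y, F μ y ∂μ).toReal ∧ ∀ η : ℝ, 0 < η → η ≤ η₀ → ¬ (∃ b : ℝ, 9 / 10 ≤ b ∧ b ≤ 1 ∧ ∃ (A : EuclideanSpace ℝ (Fin 3) →ₗᵢ[ℝ] EuclideanSpace ℝ (Fin 3)) (s : ℤ → ℤ) (z : ℤ → ℝ), Literature.MathematicalPhysics.StatisticalMechanics.IsHaggSeq s ∧ (∀ m : ℤ, 39 / 50 * b ≤ z (m + 1) - z m ∧ z (m + 1) - z m ≤ 17 / 20 * b) ∧ z 0 = 0 ∧ (∀ y : EuclideanSpace ℝ (Fin 3), dist y (0 : EuclideanSpace ℝ (Fin 3)) ≤ 4 * b → y ∈ {p : EuclideanSpace ℝ (Fin 3) | μ {p} ≠ 0} → ∃ y' : EuclideanSpace ℝ (Fin 3), y' - (0 : EuclideanSpace ℝ (Fin 3)) ∈ {p | ∃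 m i j : ℤ, p = A (((i : ℝ) • Literature.MathematicalPhysics.StatisticalMechanics.triangularVec₁ b) + ((j : ℝ) • Literature.MathematicalPhysics.StatisticalMechanics.triangularVec₂ b) + ((Literature.MathematicalPhysics.StatisticalMechanics.haggLabel s m : ℝ) • Literature.MathematicalPhysics.StatisticalMechanics.barlowOffset b) + (z m • Literature.MathematicalPhysics.StatisticalMechanics.layerNormal 1))} ∧ dist y y' ≤ η) ∧ (∀ y' : EuclideanSpace ℝ (Fin 3), y' - (0 : EuclideanSpace ℝ (Fin 3)) ∈ {p | ∃ m i j : ℤ, p = A (((i : ℝ) • Literature.MathematicalPhysics.StatisticalMechanics.triangularVec₁ b) + ((j : ℝ) • Literature.MathematicalPhysics.StatisticalMechanics.triangularVec₂ b) + ((Literature.MathematicalPhysics.StatisticalMechanics.haggLabel s m : ℝ) • Literature.MathematicalPhysics.StatisticalMechanics.barlowOffset b) + (z m • Literature.MathematicalPhysics.StatisticalMechanics.layerNormal 1))} → dist y' (0 : EuclideanSpace ℝ (Fin 3)) ≤ 5 * b → ∃ y : EuclideanSpace ℝ (Fin 3), y ∈ {p : EuclideanSpace ℝ (Fin 3) |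 μ {p} ≠ 0} ∧ dist y y' ≤ η)) → (⨅ Q : Literature.MathematicalPhysics.StatisticalMechanics.PeriodicConfiguration 3, Q.energyPerParticle Literature.MathematicalPhysics.StatisticalMechanics.lennardJones) + c * η ^ 2 ≤ (∫ y, Literature.MathematicalPhysics.StatisticalMechanics.lennardJones ‖y‖ ∂μ) / 2 + (∫⁻ y, F (MeasureTheory.Measure.map (fun z => z - y) μ) (-y) ∂μ).toReal - (∫⁻ y, F μ y ∂μ).toReal) :
    ∃ c : ℝ, 0 < c ∧ ∃ η₀ : ℝ, 0 < η₀ ∧ ∀ δ : ℝ, 0 < δ → ∀ P : MeasureTheory.Measure (MeasureTheory.Measure (EuclideanSpace ℝ (Fin 3))), MeasureTheory.IsProbabilityMeasure P → (∀ᵐ μ ∂P, (∃ S : Set (EuclideanSpace ℝ (Fin 3)), (0 : EuclideanSpace ℝ (Fin 3)) ∈ S ∧ (∀ x ∈ S, ∀ y ∈ S, x ≠ y → δ ≤ dist x y) ∧ μ = (MeasureTheory.Measure.count : MeasureTheory.Measure (EuclideanSpace ℝ (Fin 3))).restrict S)) → (∀ g : MeasureTheory.Measure (EuclideanSpace ℝ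 (Fin 3)) → EuclideanSpace ℝ (Fin 3) → ENNReal, Measurable (Function.uncurry g) → ∫⁻ μ, ∫⁻ y, g μ y ∂μ ∂P = ∫⁻ μ, ∫⁻ y, g (MeasureTheory.Measure.map (fun z => z - y) μ) (-y) ∂μ ∂P) → (∀ᵐ μ ∂P, ∀ q : EuclideanSpace ℝ (Fin 3), μ {q} ≠ 0 → Literature.Geometry.DiscreteGeometry.IsTwoShellGoodSet (1 / 16) (9 / 10) 1 {p : EuclideanSpace ℝ (Fin 3) | μ {p} ≠ 0} q) → (∀ᵐ μ ∂P, ∀ p : EuclideanSpace ℝ (Fin 3), μ {p} ≠ 0 → ∀ y : EuclideanSpace ℝ (Fin 3), (∀ q : EuclideanSpace ℝ (Fin 3), μ {q} ≠ 0 → q ≠ p → y ≠ q) → ∑' q : {q : EuclideanSpace ℝ (Fin 3) // μ {q} ≠ 0 ∧ q ≠ p}, Literature.MathematicalPhysics.StatisticalMechanics.lennardJones (dist p (q : EuclideanSpace ℝ (Fin 3))) ≤ ∑' q : {q : EuclideanSpace ℝ (Fin 3) // μ {q} ≠ 0 ∧ q ≠ p}, Literature.MathematicalPhysics.StatisticalMechanics.lennardJones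 (dist y (q : EuclideanSpace ℝ (Fin 3)))) → (∀ᵐ μ ∂P, ∃ s : ℤ → ℤ, Literature.MathematicalPhysics.StatisticalMechanics.IsHaggSeq s ∧ ∃ Φ : EuclideanSpace ℝ (Fin 3) → EuclideanSpace ℝ (Fin 3), Set.BijOn Φ (Literature.MathematicalPhysics.StatisticalMechanics.barlowStacking 1 (Real.sqrt (2 / 3)) s) {p : EuclideanSpace ℝ (Fin 3) | μ {p} ≠ 0} ∧ ∀ p ∈ Literature.MathematicalPhysics.StatisticalMechanics.barlowStacking 1 (Real.sqrt (2 / 3)) s, ∀ q ∈ Literature.MathematicalPhysics.StatisticalMechanics.barlowStacking 1 (Real.sqrt (2 / 3)) s, (dist p q = 1 ↔ (0 < dist (Φ p) (Φ q) ∧ dist (Φ p) (Φ q) ≤ 28 / 25))) → (∀ᵐ μ ∂P, ∀ q : EuclideanSpace ℝ (Fin 3), μ {q} ≠ 0 → ∃ b : ℝ, 9 / 10 ≤ b ∧ b ≤ 1 ∧ ∃ (A : EuclideanSpace ℝ (Fin 3) →ₗᵢ[ℝ] EuclideanSpace ℝ (Fin 3)) (s : ℤ → ℤ) (z : ℤ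 → ℝ), Literature.MathematicalPhysics.StatisticalMechanics.IsHaggSeq s ∧ (∀ m : ℤ, 39 / 50 * b ≤ z (m + 1) - z m ∧ z (m + 1) - z m ≤ 17 / 20 * b) ∧ z 0 = 0 ∧ (∀ y : EuclideanSpace ℝ (Fin 3), dist y q ≤ 4 * b → μ {y} ≠ 0 → ∃ y' : EuclideanSpace ℝ (Fin 3), y' - q ∈ {p | ∃ m i j : ℤ, p = A (((i : ℝ) • Literature.MathematicalPhysics.StatisticalMechanics.triangularVec₁ b) + ((j : ℝ) • Literature.MathematicalPhysics.StatisticalMechanics.triangularVec₂ b) + ((Literature.MathematicalPhysics.StatisticalMechanics.haggLabel s m : ℝ) • Literature.MathematicalPhysics.StatisticalMechanics.barlowOffset b) + (z m • Literature.MathematicalPhysics.StatisticalMechanics.layerNormal 1))} ∧ dist y y' ≤ 1 / 50) ∧ (∀ y' : EuclideanSpace ℝ (Fin 3), y' - q ∈ {p | ∃ m i j : ℤ, p = A (((i : ℝ) • Literature.MathematicalPhysics.StatisticalMechanics.triangularVec₁ b) + ((j : ℝ) • Literature.MathematicalPhysics.StatisticalMechanics.triangularVec₂ b) + ((Literature.MathematicalPhysics.StatisticalMechanics.haggLabel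 s m : ℝ) • Literature.MathematicalPhysics.StatisticalMechanics.barlowOffset b) + (z m • Literature.MathematicalPhysics.StatisticalMechanics.layerNormal 1))} → dist y' q ≤ 5 * b → ∃ y : EuclideanSpace ℝ (Fin 3), μ {y} ≠ 0 ∧ dist y y' ≤ 1 / 50)) → ∃ m : (MeasureTheory.Measure (EuclideanSpace ℝ (Fin 3))) → ENNReal, Measurable m ∧ (∀ᵐ μ ∂P, ∀ η : ℝ, 0 < η → η ≤ η₀ → ¬ (∃ b : ℝ, 9 / 10 ≤ b ∧ b ≤ 1 ∧ ∃ (A : EuclideanSpace ℝ (Fin 3) →ₗᵢ[ℝ] EuclideanSpace ℝ (Fin 3)) (s : ℤ → ℤ) (z : ℤ → ℝ), Literature.MathematicalPhysics.StatisticalMechanics.IsHaggSeq s ∧ (∀ m : ℤ, 39 / 50 * b ≤ z (m + 1) - z m ∧ z (m + 1) - z m ≤ 17 / 20 * b) ∧ z 0 = 0 ∧ (∀ y : EuclideanSpace ℝ (Fin 3), dist y (0 : EuclideanSpace ℝ (Fin 3)) ≤ 4 * b → y ∈ {p : EuclideanSpace ℝ (Fin 3) | μ {p} ≠ 0} → ∃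 y' : EuclideanSpace ℝ (Fin 3), y' - (0 : EuclideanSpace ℝ (Fin 3)) ∈ {p | ∃ m i j : ℤ, p = A (((i : ℝ) • Literature.MathematicalPhysics.StatisticalMechanics.triangularVec₁ b) + ((j : ℝ) • Literature.MathematicalPhysics.StatisticalMechanics.triangularVec₂ b) + ((Literature.MathematicalPhysics.StatisticalMechanics.haggLabel s m : ℝ) • Literature.MathematicalPhysics.StatisticalMechanics.barlowOffset b) + (z m • Literature.MathematicalPhysics.StatisticalMechanics.layerNormal 1))} ∧ dist y y' ≤ η) ∧ (∀ y' : EuclideanSpace ℝ (Fin 3), y' - (0 : EuclideanSpace ℝ (Fin 3)) ∈ {p | ∃ m i j : ℤ, p = A (((i : ℝ) • Literature.MathematicalPhysics.StatisticalMechanics.triangularVec₁ b) + ((j : ℝ) • Literature.MathematicalPhysics.StatisticalMechanics.triangularVec₂ b) + ((Literature.MathematicalPhysics.StatisticalMechanics.haggLabel s m : ℝ) • Literature.MathematicalPhysics.StatisticalMechanics.barlowOffset b) + (z m • Literature.MathematicalPhysics.StatisticalMechanics.layerNormal 1))} → dist y' (0 : EuclideanSpace ℝ (Fin 3)) ≤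 5 * b → ∃ y : EuclideanSpace ℝ (Fin 3), y ∈ {p : EuclideanSpace ℝ (Fin 3) | μ {p} ≠ 0} ∧ dist y y' ≤ η)) → ENNReal.ofReal η ≤ m μ) ∧ (∫⁻ μ, m μ ^ 2 ∂P) ≠ ⊤ ∧ (⨅ Q : Literature.MathematicalPhysics.StatisticalMechanics.PeriodicConfiguration 3, Q.energyPerParticle Literature.MathematicalPhysics.StatisticalMechanics.lennardJones) + c * (∫⁻ μ, m μ ^ 2 ∂P).toReal ≤ (∫ μ, (∫ y, Literature.MathematicalPhysics.StatisticalMechanics.lennardJones ‖y‖ ∂μ) / 2 ∂P) :=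
  quadMeanCoercivity_of_pertSiteCalibration (1 / 50) hK

/-- **KPERT(ν) ⟹ PERT(ν)** (the perturbative regime of N: a.s. matched at EVERY tolerance at the root), def-free: QMC by the theorem above, then
Markov + zero excess (the g18 kernels `cPert_of_qmc`, `pertRegime_of_cPert` inlined on expanded texts). -/
theorem pertRegime_of_pertSiteCalibration (ν : ℝ)
    (hK : ∃ c : ℝ, 0 < c ∧ ∃ η₀ : ℝ, 0 < η₀ ∧ ∀ δ : ℝ, 0 < δ → ∃ C : NNReal, ∃ F : MeasureTheory.Measure (EuclideanSpace ℝ (Fin 3)) → EuclideanSpace ℝ (Fin 3) → ENNReal, Measurable (Function.uncurry F) ∧ ∀ μ : MeasureTheory.Measure (EuclideanSpace ℝ (Fin 3)), (∃ S : Set (EuclideanSpace ℝ (Fin 3)), (0 : EuclideanSpace ℝ (Fin 3)) ∈ S ∧ (∀ x ∈ S, ∀ y ∈ S, x ≠ y → δ ≤ dist x y) ∧ μ = (MeasureTheory.Measure.count : MeasureTheory.Measure (EuclideanSpace ℝ (Fin 3))).restrict S) → (∀ q : EuclideanSpace ℝ (Fin 3), μ {q} ≠ 0 → Literature.Geometry.DiscreteGeometry.IsTwoShellGoodSet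 (1 / 16) (9 / 10) 1 {p : EuclideanSpace ℝ (Fin 3) | μ {p} ≠ 0} q) → (∀ p : EuclideanSpace ℝ (Fin 3), μ {p} ≠ 0 → ∀ y : EuclideanSpace ℝ (Fin 3), (∀ q : EuclideanSpace ℝ (Fin 3), μ {q} ≠ 0 → q ≠ p → y ≠ q) → ∑' q : {q : EuclideanSpace ℝ (Fin 3) // μ {q} ≠ 0 ∧ q ≠ p}, Literature.MathematicalPhysics.StatisticalMechanics.lennardJones (dist p (q : EuclideanSpace ℝ (Fin 3))) ≤ ∑' q : {q : EuclideanSpace ℝ (Fin 3) // μ {q} ≠ 0 ∧ q ≠ p}, Literature.MathematicalPhysics.StatisticalMechanics.lennardJones (dist y (q : EuclideanSpace ℝ (Fin 3)))) → (∃ s : ℤ → ℤ, Literature.MathematicalPhysics.StatisticalMechanics.IsHaggSeq s ∧ ∃ Φ : EuclideanSpace ℝ (Fin 3) → EuclideanSpace ℝ (Fin 3), Set.BijOn Φ (Literature.MathematicalPhysics.StatisticalMechanics.barlowStacking 1 (Real.sqrt (2 / 3)) s) {p : EuclideanSpace ℝ (Fin 3) | μ {p} ≠ 0} ∧ ∀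 p ∈ Literature.MathematicalPhysics.StatisticalMechanics.barlowStacking 1 (Real.sqrt (2 / 3)) s, ∀ q ∈ Literature.MathematicalPhysics.StatisticalMechanics.barlowStacking 1 (Real.sqrt (2 / 3)) s, (dist p q = 1 ↔ (0 < dist (Φ p) (Φ q) ∧ dist (Φ p) (Φ q) ≤ 28 / 25))) → (∀ q : EuclideanSpace ℝ (Fin 3), μ {q} ≠ 0 → ∃ b : ℝ, 9 / 10 ≤ b ∧ b ≤ 1 ∧ ∃ (A : EuclideanSpace ℝ (Fin 3) →ₗᵢ[ℝ] EuclideanSpace ℝ (Fin 3)) (s : ℤ → ℤ) (z : ℤ → ℝ), Literature.MathematicalPhysics.StatisticalMechanics.IsHaggSeq s ∧ (∀ m : ℤ, 39 / 50 * b ≤ z (m + 1) - z m ∧ z (m + 1) - z m ≤ 17 / 20 * b) ∧ z 0 = 0 ∧ (∀ y : EuclideanSpace ℝ (Fin 3), dist y q ≤ 4 * b → μ {y} ≠ 0 → ∃ y' : EuclideanSpace ℝ (Fin 3), y' - q ∈ {p | ∃ m i j : ℤ, p = A (((i : ℝ) • Literature.MathematicalPhysics.StatisticalMechanics.triangularVec₁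 b) + ((j : ℝ) • Literature.MathematicalPhysics.StatisticalMechanics.triangularVec₂ b) + ((Literature.MathematicalPhysics.StatisticalMechanics.haggLabel s m : ℝ) • Literature.MathematicalPhysics.StatisticalMechanics.barlowOffset b) + (z m • Literature.MathematicalPhysics.StatisticalMechanics.layerNormal 1))} ∧ dist y y' ≤ ν) ∧ (∀ y' : EuclideanSpace ℝ (Fin 3), y' - q ∈ {p | ∃ m i j : ℤ, p = A (((i : ℝ) • Literature.MathematicalPhysics.StatisticalMechanics.triangularVec₁ b) + ((j : ℝ) • Literature.MathematicalPhysics.StatisticalMechanics.triangularVec₂ b) + ((Literature.MathematicalPhysics.StatisticalMechanics.haggLabel s m : ℝ) • Literature.MathematicalPhysics.StatisticalMechanics.barlowOffset b) + (z m • Literature.MathematicalPhysics.StatisticalMechanics.layerNormal 1))} → dist y' q ≤ 5 * b → ∃ y : EuclideanSpace ℝ (Fin 3), μ {y} ≠ 0 ∧ dist y y' ≤ ν)) → (∫⁻ y, F μ y ∂μ) ≤ (C : ENNReal) ∧ (⨅ Q : Literature.MathematicalPhysics.StatisticalMechanics.PeriodicConfiguration 3, Q.energyPerParticle Literature.MathematicalPhysics.StatisticalMechanics.lennardJones)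 ≤ (∫ y, Literature.MathematicalPhysics.StatisticalMechanics.lennardJones ‖y‖ ∂μ) / 2 + (∫⁻ y, F (MeasureTheory.Measure.map (fun z => z - y) μ) (-y) ∂μ).toReal - (∫⁻ y, F μ y ∂μ).toReal ∧ ∀ η : ℝ, 0 < η → η ≤ η₀ → ¬ (∃ b : ℝ, 9 / 10 ≤ b ∧ b ≤ 1 ∧ ∃ (A : EuclideanSpace ℝ (Fin 3) →ₗᵢ[ℝ] EuclideanSpace ℝ (Fin 3)) (s : ℤ → ℤ) (z : ℤ → ℝ), Literature.MathematicalPhysics.StatisticalMechanics.IsHaggSeq s ∧ (∀ m : ℤ, 39 / 50 * b ≤ z (m + 1) - z m ∧ z (m + 1) - z m ≤ 17 / 20 * b) ∧ z 0 = 0 ∧ (∀ y : EuclideanSpace ℝ (Fin 3), dist y (0 : EuclideanSpace ℝ (Fin 3)) ≤ 4 * b → y ∈ {p : EuclideanSpace ℝ (Fin 3) | μ {p} ≠ 0} → ∃ y' : EuclideanSpace ℝ (Fin 3), y' - (0 : EuclideanSpace ℝ (Fin 3)) ∈ {p | ∃ m i j : ℤ, p = A (((i : ℝ) • Literature.MathematicalPhysics.StatisticalMechanics.triangularVec₁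 b) + ((j : ℝ) • Literature.MathematicalPhysics.StatisticalMechanics.triangularVec₂ b) + ((Literature.MathematicalPhysics.StatisticalMechanics.haggLabel s m : ℝ) • Literature.MathematicalPhysics.StatisticalMechanics.barlowOffset b) + (z m • Literature.MathematicalPhysics.StatisticalMechanics.layerNormal 1))} ∧ dist y y' ≤ η) ∧ (∀ y' : EuclideanSpace ℝ (Fin 3), y' - (0 : EuclideanSpace ℝ (Fin 3)) ∈ {p | ∃ m i j : ℤ, p = A (((i : ℝ) • Literature.MathematicalPhysics.StatisticalMechanics.triangularVec₁ b) + ((j : ℝ) • Literature.MathematicalPhysics.StatisticalMechanics.triangularVec₂ b) + ((Literature.MathematicalPhysics.StatisticalMechanics.haggLabel s m : ℝ) • Literature.MathematicalPhysics.StatisticalMechanics.barlowOffset b) + (z m • Literature.MathematicalPhysics.StatisticalMechanics.layerNormal 1))} → dist y' (0 : EuclideanSpace ℝ (Fin 3)) ≤ 5 * b → ∃ y : EuclideanSpace ℝ (Fin 3), y ∈ {p : EuclideanSpace ℝ (Fin 3) | μ {p} ≠ 0} ∧ dist y y' ≤ η)) → (⨅ Q : Literature.MathematicalPhysics.StatisticalMechanics.PeriodicConfiguration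 3, Q.energyPerParticle Literature.MathematicalPhysics.StatisticalMechanics.lennardJones) + c * η ^ 2 ≤ (∫ y, Literature.MathematicalPhysics.StatisticalMechanics.lennardJones ‖y‖ ∂μ) / 2 + (∫⁻ y, F (MeasureTheory.Measure.map (fun z => z - y) μ) (-y) ∂μ).toReal - (∫⁻ y, F μ y ∂μ).toReal) :
    ∀ δ : ℝ, 0 < δ → ∀ P : MeasureTheory.Measure (MeasureTheory.Measure (EuclideanSpace ℝ (Fin 3))), MeasureTheory.IsProbabilityMeasure P → (∀ᵐ μ ∂P, (∃ S : Set (EuclideanSpace ℝ (Fin 3)), (0 : EuclideanSpace ℝ (Fin 3)) ∈ S ∧ (∀ x ∈ S, ∀ y ∈ S, x ≠ y → δ ≤ dist x y) ∧ μ = (MeasureTheory.Measure.count : MeasureTheory.Measure (EuclideanSpace ℝ (Fin 3))).restrict S)) → (∀ g : MeasureTheory.Measure (EuclideanSpace ℝ (Fin 3)) → EuclideanSpace ℝ (Fin 3) → ENNReal, Measurable (Function.uncurry g) → ∫⁻ μ, ∫⁻ y, g μ y ∂μ ∂P = ∫⁻ μ, ∫⁻ y, g (MeasureTheory.Measure.map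 (fun z => z - y) μ) (-y) ∂μ ∂P) → (∫ μ, (∫ y, Literature.MathematicalPhysics.StatisticalMechanics.lennardJones ‖y‖ ∂μ) / 2 ∂P) ≤ (⨅ Q : Literature.MathematicalPhysics.StatisticalMechanics.PeriodicConfiguration 3, Q.energyPerParticle Literature.MathematicalPhysics.StatisticalMechanics.lennardJones) → (∀ᵐ μ ∂P, ∀ q : EuclideanSpace ℝ (Fin 3), μ {q} ≠ 0 → Literature.Geometry.DiscreteGeometry.IsTwoShellGoodSet (1 / 16) (9 / 10) 1 {p : EuclideanSpace ℝ (Fin 3) | μ {p} ≠ 0} q) → (∀ᵐ μ ∂P, ∀ p : EuclideanSpace ℝ (Fin 3), μ {p} ≠ 0 → ∀ y : EuclideanSpace ℝ (Fin 3), (∀ q : EuclideanSpace ℝ (Fin 3), μ {q} ≠ 0 → q ≠ p → y ≠ q) → ∑' q : {q : EuclideanSpace ℝ (Fin 3) // μ {q} ≠ 0 ∧ q ≠ p}, Literature.MathematicalPhysics.StatisticalMechanics.lennardJones (dist p (q : EuclideanSpace ℝ (Fin 3))) ≤ ∑' q : {q : EuclideanSpace ℝ (Fin 3) // μ {q} ≠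 0 ∧ q ≠ p}, Literature.MathematicalPhysics.StatisticalMechanics.lennardJones (dist y (q : EuclideanSpace ℝ (Fin 3)))) → (∀ᵐ μ ∂P, ∃ s : ℤ → ℤ, Literature.MathematicalPhysics.StatisticalMechanics.IsHaggSeq s ∧ ∃ Φ : EuclideanSpace ℝ (Fin 3) → EuclideanSpace ℝ (Fin 3), Set.BijOn Φ (Literature.MathematicalPhysics.StatisticalMechanics.barlowStacking 1 (Real.sqrt (2 / 3)) s) {p : EuclideanSpace ℝ (Fin 3) | μ {p} ≠ 0} ∧ ∀ p ∈ Literature.MathematicalPhysics.StatisticalMechanics.barlowStacking 1 (Real.sqrt (2 / 3)) s, ∀ q ∈ Literature.MathematicalPhysics.StatisticalMechanics.barlowStacking 1 (Real.sqrt (2 / 3)) s, (dist p q = 1 ↔ (0 < dist (Φ p) (Φ q) ∧ dist (Φ p) (Φ q) ≤ 28 / 25))) → (∀ᵐ μ ∂P, ∀ q : EuclideanSpace ℝ (Fin 3), μ {q} ≠ 0 → ∃ b : ℝ, 9 / 10 ≤ b ∧ b ≤ 1 ∧ ∃ (A : EuclideanSpace ℝ (Fin 3) →ₗᵢ[ℝ]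 EuclideanSpace ℝ (Fin 3)) (s : ℤ → ℤ) (z : ℤ → ℝ), Literature.MathematicalPhysics.StatisticalMechanics.IsHaggSeq s ∧ (∀ m : ℤ, 39 / 50 * b ≤ z (m + 1) - z m ∧ z (m + 1) - z m ≤ 17 / 20 * b) ∧ z 0 = 0 ∧ (∀ y : EuclideanSpace ℝ (Fin 3), dist y q ≤ 4 * b → μ {y} ≠ 0 → ∃ y' : EuclideanSpace ℝ (Fin 3), y' - q ∈ {p | ∃ m i j : ℤ, p = A (((i : ℝ) • Literature.MathematicalPhysics.StatisticalMechanics.triangularVec₁ b) + ((j : ℝ) • Literature.MathematicalPhysics.StatisticalMechanics.triangularVec₂ b) + ((Literature.MathematicalPhysics.StatisticalMechanics.haggLabel s m : ℝ) • Literature.MathematicalPhysics.StatisticalMechanics.barlowOffset b) + (z m • Literature.MathematicalPhysics.StatisticalMechanics.layerNormal 1))} ∧ dist y y' ≤ ν) ∧ (∀ y' : EuclideanSpace ℝ (Fin 3), y' - q ∈ {p | ∃ m i j : ℤ, p = A (((i : ℝ) • Literature.MathematicalPhysics.StatisticalMechanics.triangularVec₁ b) + ((j : ℝ) • Literature.MathematicalPhysics.StatisticalMechanics.triangularVec₂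 b) + ((Literature.MathematicalPhysics.StatisticalMechanics.haggLabel s m : ℝ) • Literature.MathematicalPhysics.StatisticalMechanics.barlowOffset b) + (z m • Literature.MathematicalPhysics.StatisticalMechanics.layerNormal 1))} → dist y' q ≤ 5 * b → ∃ y : EuclideanSpace ℝ (Fin 3), μ {y} ≠ 0 ∧ dist y y' ≤ ν)) → ∀ᵐ μ ∂P, ∀ η : ℝ, 0 < η → ∃ b : ℝ, 9 / 10 ≤ b ∧ b ≤ 1 ∧ ∃ (A : EuclideanSpace ℝ (Fin 3) →ₗᵢ[ℝ] EuclideanSpace ℝ (Fin 3)) (s : ℤ → ℤ) (z : ℤ → ℝ), Literature.MathematicalPhysics.StatisticalMechanics.IsHaggSeq s ∧ (∀ m : ℤ, 39 / 50 * b ≤ z (m + 1) - z m ∧ z (m + 1) - z m ≤ 17 / 20 * b) ∧ z 0 = 0 ∧ (∀ y : EuclideanSpace ℝ (Fin 3), dist y (0 : EuclideanSpace ℝ (Fin 3)) ≤ 4 * b → μ {y} ≠ 0 → ∃ y' : EuclideanSpace ℝ (Fin 3), y' - (0 : EuclideanSpace ℝ (Fin 3)) ∈ {p | ∃ m i j :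 ℤ, p = A (((i : ℝ) • Literature.MathematicalPhysics.StatisticalMechanics.triangularVec₁ b) + ((j : ℝ) • Literature.MathematicalPhysics.StatisticalMechanics.triangularVec₂ b) + ((Literature.MathematicalPhysics.StatisticalMechanics.haggLabel s m : ℝ) • Literature.MathematicalPhysics.StatisticalMechanics.barlowOffset b) + (z m • Literature.MathematicalPhysics.StatisticalMechanics.layerNormal 1))} ∧ dist y y' ≤ η) ∧ (∀ y' : EuclideanSpace ℝ (Fin 3), y' - (0 : EuclideanSpace ℝ (Fin 3)) ∈ {p | ∃ m i j : ℤ, p = A (((i : ℝ) • Literature.MathematicalPhysics.StatisticalMechanics.triangularVec₁ b) + ((j : ℝ) • Literature.MathematicalPhysics.StatisticalMechanics.triangularVec₂ b) + ((Literature.MathematicalPhysics.StatisticalMechanics.haggLabel s m : ℝ) • Literature.MathematicalPhysics.StatisticalMechanics.barlowOffset b) + (z m • Literature.MathematicalPhysics.StatisticalMechanics.layerNormal 1))} → dist y' (0 : EuclideanSpace ℝ (Fin 3)) ≤ 5 * b → ∃ y : EuclideanSpace ℝ (Fin 3), μ {y} ≠ 0 ∧ dist y y' ≤ η) := by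
  classical
  have hQ := quadMeanCoercivity_of_pertSiteCalibration ν hK
  set M : ℝ → Measure (EuclideanSpace ℝ (Fin 3)) → Prop := fun η μ => ∃ b : ℝ, 9 / 10 ≤ b ∧ b ≤ 1 ∧ ∃ (A : EuclideanSpace ℝ (Fin 3) →ₗᵢ[ℝ] EuclideanSpace ℝ (Fin 3)) (s : ℤ → ℤ) (z : ℤ → ℝ), Literature.MathematicalPhysics.StatisticalMechanics.IsHaggSeq s ∧ (∀ m : ℤ, 39 / 50 * b ≤ z (m + 1) - z m ∧ z (m + 1) - z m ≤ 17 / 20 * b) ∧ z 0 = 0 ∧ (∀ y : EuclideanSpace ℝ (Fin 3), dist y (0 : EuclideanSpace ℝ (Fin 3)) ≤ 4 * b → y ∈ {p : EuclideanSpace ℝ (Fin 3) | μ {p} ≠ 0} → ∃ y' : EuclideanSpace ℝ (Fin 3), y' - (0 : EuclideanSpace ℝ (Fin 3)) ∈ {p | ∃ m i j : ℤ, p = A (((i : ℝ) • Literature.MathematicalPhysics.StatisticalMechanics.triangularVec₁ b) + ((j : ℝ) • Literature.MathematicalPhysics.StatisticalMechanics.triangularVec₂ b) + ((Literature.MathematicalPhysics.StatisticalMechanics.haggLabel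 s m : ℝ) • Literature.MathematicalPhysics.StatisticalMechanics.barlowOffset b) + (z m • Literature.MathematicalPhysics.StatisticalMechanics.layerNormal 1))} ∧ dist y y' ≤ η) ∧ (∀ y' : EuclideanSpace ℝ (Fin 3), y' - (0 : EuclideanSpace ℝ (Fin 3)) ∈ {p | ∃ m i j : ℤ, p = A (((i : ℝ) • Literature.MathematicalPhysics.StatisticalMechanics.triangularVec₁ b) + ((j : ℝ) • Literature.MathematicalPhysics.StatisticalMechanics.triangularVec₂ b) + ((Literature.MathematicalPhysics.StatisticalMechanics.haggLabel s m : ℝ) • Literature.MathematicalPhysics.StatisticalMechanics.barlowOffset b) + (z m • Literature.MathematicalPhysics.StatisticalMechanics.layerNormal 1))} → dist y' (0 : EuclideanSpace ℝ (Fin 3)) ≤ 5 * b → ∃ y : EuclideanSpace ℝ (Fin 3), y ∈ {p : EuclideanSpace ℝ (Fin 3) | μ {p} ≠ 0} ∧ dist y y' ≤ η) with hM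
  have hmono : ∀ {η η' : ℝ}, η ≤ η' → ∀ {μ : Measure (EuclideanSpace ℝ (Fin 3))}, M η μ → M η' μ := by
    intro η η' h μ hm
    obtain ⟨b, hb1, hb2, A, s, z, hs, hg, hz, h1, h2⟩ := hm
    refine ⟨b, hb1, hb2, A, s, z, hs, hg, hz, fun y hy hyμ => ?_, fun y' hy' hd => ?_⟩
    · obtain ⟨y', hy', hd⟩ := h1 y hy hyμ
      exact ⟨y', hy', hd.trans h⟩
    · obtain ⟨y, hyμ, hd'⟩ := h2 y' hy' hd
      exact ⟨y, hyμ, hd'.trans h⟩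
  intro δ hδ P hP hroot hmecke hen hclean hnash hchart hpert
  obtain ⟨c, hc, η₀, hη₀, h⟩ := hQ
  obtain ⟨m, hm, hmaj, hfin, hle⟩ := h δ hδ P hP hroot hmecke hclean hnash hchart hpert
  haveI := hP
  have hzero : (∫⁻ μ, m μ ^ 2 ∂P).toReal ≤ 0 := by
    have h1 : c * (∫⁻ μ, m μ ^ 2 ∂P).toReal ≤ 0 := by linarith
    by_contra hcon
    linarith [mul_pos hc (not_le.mp hcon)]
  have hnull : ∀ η : ℝ, 0 < η → η ≤ η₀ → P {μ : Measure (EuclideanSpace ℝ (Fin 3)) | ¬ M η μ} = 0 := by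
    intro η hη hηle
    have hsub : P {μ : Measure (EuclideanSpace ℝ (Fin 3)) | ¬ M η μ} ≤ P {μ : Measure (EuclideanSpace ℝ (Fin 3)) | ENNReal.ofReal η ^ 2 ≤ m μ ^ 2} := by
      apply MeasureTheory.measure_mono_ae
      filter_upwards [hmaj] with μ hμ
      intro hS
      have h1 : ENNReal.ofReal η ≤ m μ := hμ η hη hηle hS
      show ENNReal.ofReal η ^ 2 ≤ m μ ^ 2
      gcongr
    have hmarkov : ENNReal.ofReal η ^ 2 * P {μ : Measure (EuclideanSpace ℝ (Fin 3)) | ENNReal.ofReal η ^ 2 ≤ m μ ^ 2} ≤ ∫⁻ μ, m μ ^ 2 ∂P :=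
      MeasureTheory.mul_meas_ge_le_lintegral₀ (hm.pow_const 2).aemeasurable _
    have h1 : ENNReal.ofReal η ^ 2 * P {μ : Measure (EuclideanSpace ℝ (Fin 3)) | ¬ M η μ} ≤ ∫⁻ μ, m μ ^ 2 ∂P := (mul_le_mul' le_rfl hsub).trans hmarkov
    have h2 : η ^ 2 * (P {μ : Measure (EuclideanSpace ℝ (Fin 3)) | ¬ M η μ}).toReal ≤ (∫⁻ μ, m μ ^ 2 ∂P).toReal := by
      have h3 := ENNReal.toReal_mono hfin h1
      rwa [ENNReal.toReal_mul, ENNReal.toReal_pow, ENNReal.toReal_ofReal hη.le] at h3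
    have h4 : (P {μ : Measure (EuclideanSpace ℝ (Fin 3)) | ¬ M η μ}).toReal ≤ 0 := by
      by_contra hcon
      have := mul_pos (pow_pos hη 2) (not_le.mp hcon)
      linarith
    have h5 : (P {μ : Measure (EuclideanSpace ℝ (Fin 3)) | ¬ M η μ}).toReal = 0 := le_antisymm h4 ENNReal.toReal_nonneg
    rw [ENNReal.toReal_eq_zero_iff] at h5
    exact h5.resolve_right (MeasureTheory.measure_ne_top P _)
  have hall : ∀ᵐ μ ∂P, ∀ n : ℕ, M (min (1 / ((n : ℝ) + 1)) η₀) μ := by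
    rw [MeasureTheory.ae_all_iff]
    intro n
    exact MeasureTheory.ae_iff.2 (hnull (min (1 / ((n : ℝ) + 1)) η₀) (lt_min (by positivity) hη₀) (min_le_right _ _))
  show ∀ᵐ μ ∂P, ∀ η : ℝ, 0 < η → M η μ
  filter_upwards [hall] with μ hn η hη0
  obtain ⟨n, hn'⟩ := exists_nat_one_div_lt hη0
  exact hmono ((min_le_left _ _).trans hn'.le) (hn n)

/-- the same at `ν₀ = 1/50`: conclusion = the text of the preview stub `stub_pertRegime` (bc/AmplitudeCut_birth.lean c966ab35). -/
theorem pertRegime_of_pertSiteCalibration_1_50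
    (hK : ∃ c : ℝ, 0 < c ∧ ∃ η₀ : ℝ, 0 < η₀ ∧ ∀ δ : ℝ, 0 < δ → ∃ C : NNReal, ∃ F : MeasureTheory.Measure (EuclideanSpace ℝ (Fin 3)) → EuclideanSpace ℝ (Fin 3) → ENNReal, Measurable (Function.uncurry F) ∧ ∀ μ : MeasureTheory.Measure (EuclideanSpace ℝ (Fin 3)), (∃ S : Set (EuclideanSpace ℝ (Fin 3)), (0 : EuclideanSpace ℝ (Fin 3)) ∈ S ∧ (∀ x ∈ S, ∀ y ∈ S, x ≠ y → δ ≤ dist x y) ∧ μ = (MeasureTheory.Measure.count : MeasureTheory.Measure (EuclideanSpace ℝ (Fin 3))).restrict S) → (∀ q : EuclideanSpace ℝ (Fin 3), μ {q} ≠ 0 → Literature.Geometry.DiscreteGeometry.IsTwoShellGoodSet (1 / 16) (9 / 10) 1 {p : EuclideanSpace ℝ (Fin 3) | μ {p} ≠ 0} q) → (∀ p : EuclideanSpace ℝ (Fin 3), μ {p} ≠ 0 → ∀ y : EuclideanSpace ℝ (Fin 3), (∀ q : EuclideanSpace ℝ (Fin 3), μ {q} ≠ 0 → q ≠ p → y ≠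 q) → ∑' q : {q : EuclideanSpace ℝ (Fin 3) // μ {q} ≠ 0 ∧ q ≠ p}, Literature.MathematicalPhysics.StatisticalMechanics.lennardJones (dist p (q : EuclideanSpace ℝ (Fin 3))) ≤ ∑' q : {q : EuclideanSpace ℝ (Fin 3) // μ {q} ≠ 0 ∧ q ≠ p}, Literature.MathematicalPhysics.StatisticalMechanics.lennardJones (dist y (q : EuclideanSpace ℝ (Fin 3)))) → (∃ s : ℤ → ℤ, Literature.MathematicalPhysics.StatisticalMechanics.IsHaggSeq s ∧ ∃ Φ : EuclideanSpace ℝ (Fin 3) → EuclideanSpace ℝ (Fin 3), Set.BijOn Φ (Literature.MathematicalPhysics.StatisticalMechanics.barlowStacking 1 (Real.sqrt (2 / 3)) s) {p : EuclideanSpace ℝ (Fin 3) | μ {p} ≠ 0} ∧ ∀ p ∈ Literature.MathematicalPhysics.StatisticalMechanics.barlowStacking 1 (Real.sqrt (2 / 3)) s, ∀ q ∈ Literature.MathematicalPhysics.StatisticalMechanics.barlowStacking 1 (Real.sqrt (2 / 3)) s, (dist p q = 1 ↔ (0 < dist (Φ p) (Φ q) ∧ dist (Φ p) (Φ q) ≤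 28 / 25))) → (∀ q : EuclideanSpace ℝ (Fin 3), μ {q} ≠ 0 → ∃ b : ℝ, 9 / 10 ≤ b ∧ b ≤ 1 ∧ ∃ (A : EuclideanSpace ℝ (Fin 3) →ₗᵢ[ℝ] EuclideanSpace ℝ (Fin 3)) (s : ℤ → ℤ) (z : ℤ → ℝ), Literature.MathematicalPhysics.StatisticalMechanics.IsHaggSeq s ∧ (∀ m : ℤ, 39 / 50 * b ≤ z (m + 1) - z m ∧ z (m + 1) - z m ≤ 17 / 20 * b) ∧ z 0 = 0 ∧ (∀ y : EuclideanSpace ℝ (Fin 3), dist y q ≤ 4 * b → μ {y} ≠ 0 → ∃ y' : EuclideanSpace ℝ (Fin 3), y' - q ∈ {p | ∃ m i j : ℤ, p = A (((i : ℝ) • Literature.MathematicalPhysics.StatisticalMechanics.triangularVec₁ b) + ((j : ℝ) • Literature.MathematicalPhysics.StatisticalMechanics.triangularVec₂ b) + ((Literature.MathematicalPhysics.StatisticalMechanics.haggLabel s m : ℝ) • Literature.MathematicalPhysics.StatisticalMechanics.barlowOffset b) + (z m • Literature.MathematicalPhysics.StatisticalMechanics.layerNormal 1))} ∧ dist y y'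 ≤ 1 / 50) ∧ (∀ y' : EuclideanSpace ℝ (Fin 3), y' - q ∈ {p | ∃ m i j : ℤ, p = A (((i : ℝ) • Literature.MathematicalPhysics.StatisticalMechanics.triangularVec₁ b) + ((j : ℝ) • Literature.MathematicalPhysics.StatisticalMechanics.triangularVec₂ b) + ((Literature.MathematicalPhysics.StatisticalMechanics.haggLabel s m : ℝ) • Literature.MathematicalPhysics.StatisticalMechanics.barlowOffset b) + (z m • Literature.MathematicalPhysics.StatisticalMechanics.layerNormal 1))} → dist y' q ≤ 5 * b → ∃ y : EuclideanSpace ℝ (Fin 3), μ {y} ≠ 0 ∧ dist y y' ≤ 1 / 50)) → (∫⁻ y, F μ y ∂μ) ≤ (C : ENNReal) ∧ (⨅ Q : Literature.MathematicalPhysics.StatisticalMechanics.PeriodicConfiguration 3, Q.energyPerParticle Literature.MathematicalPhysics.StatisticalMechanics.lennardJones) ≤ (∫ y, Literature.MathematicalPhysics.StatisticalMechanics.lennardJones ‖y‖ ∂μ) / 2 + (∫⁻ y, F (MeasureTheory.Measure.map (fun z => z - y) μ) (-y) ∂μ).toReal - (∫⁻ y, F μ y ∂μ).toReal ∧ ∀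 η : ℝ, 0 < η → η ≤ η₀ → ¬ (∃ b : ℝ, 9 / 10 ≤ b ∧ b ≤ 1 ∧ ∃ (A : EuclideanSpace ℝ (Fin 3) →ₗᵢ[ℝ] EuclideanSpace ℝ (Fin 3)) (s : ℤ → ℤ) (z : ℤ → ℝ), Literature.MathematicalPhysics.StatisticalMechanics.IsHaggSeq s ∧ (∀ m : ℤ, 39 / 50 * b ≤ z (m + 1) - z m ∧ z (m + 1) - z m ≤ 17 / 20 * b) ∧ z 0 = 0 ∧ (∀ y : EuclideanSpace ℝ (Fin 3), dist y (0 : EuclideanSpace ℝ (Fin 3)) ≤ 4 * b → y ∈ {p : EuclideanSpace ℝ (Fin 3) | μ {p} ≠ 0} → ∃ y' : EuclideanSpace ℝ (Fin 3), y' - (0 : EuclideanSpace ℝ (Fin 3)) ∈ {p | ∃ m i j : ℤ, p = A (((i : ℝ) • Literature.MathematicalPhysics.StatisticalMechanics.triangularVec₁ b) + ((j : ℝ) • Literature.MathematicalPhysics.StatisticalMechanics.triangularVec₂ b) + ((Literature.MathematicalPhysics.StatisticalMechanics.haggLabel s m : ℝ) • Literature.MathematicalPhysics.StatisticalMechanics.barlowOffset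 b) + (z m • Literature.MathematicalPhysics.StatisticalMechanics.layerNormal 1))} ∧ dist y y' ≤ η) ∧ (∀ y' : EuclideanSpace ℝ (Fin 3), y' - (0 : EuclideanSpace ℝ (Fin 3)) ∈ {p | ∃ m i j : ℤ, p = A (((i : ℝ) • Literature.MathematicalPhysics.StatisticalMechanics.triangularVec₁ b) + ((j : ℝ) • Literature.MathematicalPhysics.StatisticalMechanics.triangularVec₂ b) + ((Literature.MathematicalPhysics.StatisticalMechanics.haggLabel s m : ℝ) • Literature.MathematicalPhysics.StatisticalMechanics.barlowOffset b) + (z m • Literature.MathematicalPhysics.StatisticalMechanics.layerNormal 1))} → dist y' (0 : EuclideanSpace ℝ (Fin 3)) ≤ 5 * b → ∃ y : EuclideanSpace ℝ (Fin 3), y ∈ {p : EuclideanSpace ℝ (Fin 3) | μ {p} ≠ 0} ∧ dist y y' ≤ η)) → (⨅ Q : Literature.MathematicalPhysics.StatisticalMechanics.PeriodicConfiguration 3, Q.energyPerParticle Literature.MathematicalPhysics.StatisticalMechanics.lennardJones) + c * η ^ 2 ≤ (∫ y, Literature.MathematicalPhysics.StatisticalMechanics.lennardJones ‖y‖ ∂μ)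 / 2 + (∫⁻ y, F (MeasureTheory.Measure.map (fun z => z - y) μ) (-y) ∂μ).toReal - (∫⁻ y, F μ y ∂μ).toReal) :
    ∀ δ : ℝ, 0 < δ → ∀ P : MeasureTheory.Measure (MeasureTheory.Measure (EuclideanSpace ℝ (Fin 3))), MeasureTheory.IsProbabilityMeasure P → (∀ᵐ μ ∂P, (∃ S : Set (EuclideanSpace ℝ (Fin 3)), (0 : EuclideanSpace ℝ (Fin 3)) ∈ S ∧ (∀ x ∈ S, ∀ y ∈ S, x ≠ y → δ ≤ dist x y) ∧ μ = (MeasureTheory.Measure.count : MeasureTheory.Measure (EuclideanSpace ℝ (Fin 3))).restrict S)) → (∀ g : MeasureTheory.Measure (EuclideanSpace ℝ (Fin 3)) → EuclideanSpace ℝ (Fin 3) → ENNReal, Measurable (Function.uncurry g) → ∫⁻ μ, ∫⁻ y, g μ y ∂μ ∂P = ∫⁻ μ, ∫⁻ y, g (MeasureTheory.Measure.map (fun z => z - y) μ) (-y) ∂μ ∂P) → (∫ μ, (∫ y, Literature.MathematicalPhysics.StatisticalMechanics.lennardJones ‖y‖ ∂μ) / 2 ∂P) ≤ (⨅ Q :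 Literature.MathematicalPhysics.StatisticalMechanics.PeriodicConfiguration 3, Q.energyPerParticle Literature.MathematicalPhysics.StatisticalMechanics.lennardJones) → (∀ᵐ μ ∂P, ∀ q : EuclideanSpace ℝ (Fin 3), μ {q} ≠ 0 → Literature.Geometry.DiscreteGeometry.IsTwoShellGoodSet (1 / 16) (9 / 10) 1 {p : EuclideanSpace ℝ (Fin 3) | μ {p} ≠ 0} q) → (∀ᵐ μ ∂P, ∀ p : EuclideanSpace ℝ (Fin 3), μ {p} ≠ 0 → ∀ y : EuclideanSpace ℝ (Fin 3), (∀ q : EuclideanSpace ℝ (Fin 3), μ {q} ≠ 0 → q ≠ p → y ≠ q) → ∑' q : {q : EuclideanSpace ℝ (Fin 3) // μ {q} ≠ 0 ∧ q ≠ p}, Literature.MathematicalPhysics.StatisticalMechanics.lennardJones (dist p (q : EuclideanSpace ℝ (Fin 3))) ≤ ∑' q : {q : EuclideanSpace ℝ (Fin 3) // μ {q} ≠ 0 ∧ q ≠ p}, Literature.MathematicalPhysics.StatisticalMechanics.lennardJones (dist y (q : EuclideanSpace ℝ (Fin 3)))) → (∀ᵐ μ ∂P, ∃ s : ℤ → ℤ,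 Literature.MathematicalPhysics.StatisticalMechanics.IsHaggSeq s ∧ ∃ Φ : EuclideanSpace ℝ (Fin 3) → EuclideanSpace ℝ (Fin 3), Set.BijOn Φ (Literature.MathematicalPhysics.StatisticalMechanics.barlowStacking 1 (Real.sqrt (2 / 3)) s) {p : EuclideanSpace ℝ (Fin 3) | μ {p} ≠ 0} ∧ ∀ p ∈ Literature.MathematicalPhysics.StatisticalMechanics.barlowStacking 1 (Real.sqrt (2 / 3)) s, ∀ q ∈ Literature.MathematicalPhysics.StatisticalMechanics.barlowStacking 1 (Real.sqrt (2 / 3)) s, (dist p q = 1 ↔ (0 < dist (Φ p) (Φ q) ∧ dist (Φ p) (Φ q) ≤ 28 / 25))) → (∀ᵐ μ ∂P, ∀ q : EuclideanSpace ℝ (Fin 3), μ {q} ≠ 0 → ∃ b : ℝ, 9 / 10 ≤ b ∧ b ≤ 1 ∧ ∃ (A : EuclideanSpace ℝ (Fin 3) →ₗᵢ[ℝ] EuclideanSpace ℝ (Fin 3)) (s : ℤ → ℤ) (z : ℤ → ℝ), Literature.MathematicalPhysics.StatisticalMechanics.IsHaggSeq s ∧ (∀ m : ℤ, 39 / 50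 * b ≤ z (m + 1) - z m ∧ z (m + 1) - z m ≤ 17 / 20 * b) ∧ z 0 = 0 ∧ (∀ y : EuclideanSpace ℝ (Fin 3), dist y q ≤ 4 * b → μ {y} ≠ 0 → ∃ y' : EuclideanSpace ℝ (Fin 3), y' - q ∈ {p | ∃ m i j : ℤ, p = A (((i : ℝ) • Literature.MathematicalPhysics.StatisticalMechanics.triangularVec₁ b) + ((j : ℝ) • Literature.MathematicalPhysics.StatisticalMechanics.triangularVec₂ b) + ((Literature.MathematicalPhysics.StatisticalMechanics.haggLabel s m : ℝ) • Literature.MathematicalPhysics.StatisticalMechanics.barlowOffset b) + (z m • Literature.MathematicalPhysics.StatisticalMechanics.layerNormal 1))} ∧ dist y y' ≤ 1 / 50) ∧ (∀ y' : EuclideanSpace ℝ (Fin 3), y' - q ∈ {p | ∃ m i j : ℤ, p = A (((i : ℝ) • Literature.MathematicalPhysics.StatisticalMechanics.triangularVec₁ b) + ((j : ℝ) • Literature.MathematicalPhysics.StatisticalMechanics.triangularVec₂ b) + ((Literature.MathematicalPhysics.StatisticalMechanics.haggLabel s m : ℝ) • Literature.MathematicalPhysics.StatisticalMechanics.barlowOffset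 b) + (z m • Literature.MathematicalPhysics.StatisticalMechanics.layerNormal 1))} → dist y' q ≤ 5 * b → ∃ y : EuclideanSpace ℝ (Fin 3), μ {y} ≠ 0 ∧ dist y y' ≤ 1 / 50)) → ∀ᵐ μ ∂P, ∀ η : ℝ, 0 < η → ∃ b : ℝ, 9 / 10 ≤ b ∧ b ≤ 1 ∧ ∃ (A : EuclideanSpace ℝ (Fin 3) →ₗᵢ[ℝ] EuclideanSpace ℝ (Fin 3)) (s : ℤ → ℤ) (z : ℤ → ℝ), Literature.MathematicalPhysics.StatisticalMechanics.IsHaggSeq s ∧ (∀ m : ℤ, 39 / 50 * b ≤ z (m + 1) - z m ∧ z (m + 1) - z m ≤ 17 / 20 * b) ∧ z 0 = 0 ∧ (∀ y : EuclideanSpace ℝ (Fin 3), dist y (0 : EuclideanSpace ℝ (Fin 3)) ≤ 4 * b → μ {y} ≠ 0 → ∃ y' : EuclideanSpace ℝ (Fin 3), y' - (0 : EuclideanSpace ℝ (Fin 3)) ∈ {p | ∃ m i j : ℤ, p = A (((i : ℝ) • Literature.MathematicalPhysics.StatisticalMechanics.triangularVec₁ b) + ((j : ℝ) • Literature.MathematicalPhysics.StatisticalMechanics.triangularVec₂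 b) + ((Literature.MathematicalPhysics.StatisticalMechanics.haggLabel s m : ℝ) • Literature.MathematicalPhysics.StatisticalMechanics.barlowOffset b) + (z m • Literature.MathematicalPhysics.StatisticalMechanics.layerNormal 1))} ∧ dist y y' ≤ η) ∧ (∀ y' : EuclideanSpace ℝ (Fin 3), y' - (0 : EuclideanSpace ℝ (Fin 3)) ∈ {p | ∃ m i j : ℤ, p = A (((i : ℝ) • Literature.MathematicalPhysics.StatisticalMechanics.triangularVec₁ b) + ((j : ℝ) • Literature.MathematicalPhysics.StatisticalMechanics.triangularVec₂ b) + ((Literature.MathematicalPhysics.StatisticalMechanics.haggLabel s m : ℝ) • Literature.MathematicalPhysics.StatisticalMechanics.barlowOffset b) + (z m • Literature.MathematicalPhysics.StatisticalMechanics.layerNormal 1))} → dist y' (0 : EuclideanSpace ℝ (Fin 3)) ≤ 5 * b → ∃ y : EuclideanSpace ℝ (Fin 3), μ {y} ≠ 0 ∧ dist y y' ≤ η) :=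
  pertRegime_of_pertSiteCalibration (1 / 50) hK

end Summit.AtomisticToContinuum.Crystallization.Theorems.ChartedPlanarOrderPertCalibration
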